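import Summits.ValiantsHypothesis.ValiantsHypothesis.Theses.RigidityForcesSymmetry
import Summits.ValiantsHypothesis.ValiantsHypothesis.Theorems.BorderApolarityToricWitnessObstructionQPStubTorusBound

/-!
# Line `PairTiedTorusBound` — forward rung over the PROVED floor `TorusBound`
# (crux `RankRigidMinimalRepr`, stmt-ValiantsHypothesis-18034, route `RigidityForcesSymmetry`)

FORWARD: generator=rung ; seed=g1-ValiantsHypothesis-4164 ;
witness=Summit.ValiantsHypothesis.ValiantsHypothesis.Theorems.BorderApolarityToricWitnessObstructionQP.stub_torusBound ;
rung_of=Summit.ValiantsHypothesis.ValiantsHypothesis.Theses.RigidityForcesSymmetry.TorusBound ;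
rung_decl=Summit.ValiantsHypothesis.ValiantsHypothesis.Cruxes.RankRigidMinimalRepr.PairTiedTorusBound.PairTiedTorusBound ;
step=hypothesis: equivariance under the two-sided torus `x_{kj} ↦ d_k e_j x_{kj}` weakened to its
codimension-one subtorus `e_0 = e_1` (one pair of columns tied).

FLOOR (tree theorem `stub_torusBound`, = `RigidityForcesSymmetry.TorusBound`, stmt-4164, PROVED): for
`m ≥ 3` every two-sided-torus-equivariant (exact lifts) affine determinantal representation of `perm_m`
over `ℂ` has size `n ≥ 2^m - 1`.

GRADED FAMILY `TiedTorusBound k`: the same bound assuming equivariance only under the subtorus whose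
column scalars `e_0, …, e_k` are tied.  `k = 0` is the floor (`tiedTorusBound_zero_iff`, and the
compiled witness `floor_rung : TiedTorusBound 0`); `k = 1` is THE RUNG `PairTiedTorusBound`; all columns
tied (`k ≥ m - 1`) is the left (row) torus alone, `LeftTorusBound` (`leftTorusBound_iff`) = Grenet is
optimal among UNORDERED row-set-multilinear ABPs; beyond the family, no symmetry at all is the route's
target `GrenetLowerBound` (≡ the crux, `CruxCalibration.lean`) ⇒ `VP ≠ VNP` (`GrenetBoundToVH_proof`).

WHY THE FLOOR'S PROOF STOPS AT THE RUNG.  `stub_torusBound` takes ONE generic torus element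
`diag(p) ⊗ diag(q)` (`2m` distinct primes) and counts generalised eigenspaces of its lift `P`: every
`σ ∈ 𝔖_m` is served at every level `s` by a weight `γ₀ ∏_{k∈I} p_k q_{σ k}` (`torusBound_served`), the
weight DETERMINES the pair `(I, σ I)` (`hwt` in `torusBound_levelCount`, seed file l.95–112, from
`torusBound_ind_injective` l.211 and unique factorisation), and a pair serves only `s!(m-s)!`
permutations, so level `s` carries `≥ C(m,s)` independent eigenspaces.  With `q_0 = q_1` the weight no
longer determines the pair: `(I, J ∪ {0})` and `(I, J ∪ {1})` share an eigenspace, a tied class serves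
`2·s!(m-s)!` permutations, and the pigeonhole certifies only `C(m,s)/2` eigenspaces per level (and the
restriction `x_{m-1,1} = 1`, rest of that row/column `0` only returns the floor for `perm_{m-1}`:
`2^{m-1} - 1`).  The missing factor `2` is a DIMENSION statement about tied eigenspaces, not a count of
distinct eigenvalues: this line recasts the eigenspace structure as TYPED LEVEL DECOMPOSITIONS of
`perm_m` (`stub_levelDecomp`, the regular-representation ⇒ graded-ABP dictionary of LR17 §3–§6 run for a
tied torus) and asks for the sharp count of typed products at each level (`stub_levelBound`, the new
mathematics: a tied class `(I, J∪{0} ~ J∪{1})` that is used for both completions costs two products,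
because the cross terms `x_{·0}…x_{·0}` / `x_{·1}…x_{·1}` it creates are absent from `perm_m` and can only
be cancelled at the price of further typed products at the same level).

`PairTiedTorusBound_proof : PairTiedTorusBound` (from the two stubs BY NAME) and the hypothesis form
`PairTiedTorusBound_of : <stub_levelDecomp> → <stub_levelBound> → TiedTorusBound 1` are proved below
(arithmetic: `n ≥ 1 + Σ_{s=1}^{m-1} C(m,s) = 2^m - 1`).
-/

open Literature.Computability.AlgebraicComplexity

-- the mandated summit-side namespace repeats a component by design (single-problem summit)
set_option linter.dupNamespace false

namespace Summit.ValiantsHypothesis.ValiantsHypothesis.Cruxes.RankRigidMinimalRepr.PairTiedTorusBound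

/-- Generators of the two-sided torus `x_{kj} ↦ d_k e_j x_{kj}` whose column scalars are tied on the
columns `j ≤ k` (`e j = e j'` whenever `j, j' ≤ k`). -/
def tiedTorusGen (m k : ℕ) : Set (GL (Fin m × Fin m) ℂ) :=
  {γ | ∃ d e : Fin m → ℂ, (∀ j j' : Fin m, j.val ≤ k → j'.val ≤ k → e j = e j') ∧
    (γ : Matrix (Fin m × Fin m) (Fin m × Fin m) ℂ) = Matrix.diagonal (fun p => d p.1 * e p.2)}

/-- The tied torus: subgroup generated by `tiedTorusGen m k`. -/
def tiedTorus (m k : ℕ) : Subgroup (GL (Fin m × Fin m) ℂ) :=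
  Subgroup.closure (tiedTorusGen m k)

/-- Grenet's bound `2^m - 1 ≤ n` for every `H m`-equivariant affine determinantal representation of
`perm_m`, `m ≥ 3` (the shape of `TorusBound`, with the symmetry group as a parameter). -/
def EquivariantGrenetBound (H : ∀ m : ℕ, Subgroup (GL (Fin m × Fin m) ℂ)) : Prop :=
  ∀ m : ℕ, 3 ≤ m → ∀ (n : ℕ) (A : Matrix (Fin n) (Fin n) (MvPolynomial (Fin m × Fin m) ℂ)),
    IsEquivariantDetRepr (H m) (perPoly (Fin m) ℂ) A → 2 ^ m - 1 ≤ n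

/-- The graded family: Grenet's bound under the torus with the first `k+1` columns tied. -/
def TiedTorusBound (k : ℕ) : Prop :=
  EquivariantGrenetBound (fun m => tiedTorus m k)

/-- **THE RUNG.** Grenet's bound under the two-sided torus with ONE pair of columns tied
(a codimension-one subtorus of the floor's torus). -/
def PairTiedTorusBound : Prop :=
  TiedTorusBound 1

/-- Generators of the left (row) torus `x_{kj} ↦ d_k x_{kj}`. -/
def leftTorusGen (m : ℕ) : Set (GL (Fin m × Fin m) ℂ) :=
  {γ | ∃ d : Fin m → ℂ,
    (γ : Matrix (Fin m × Fin m) (Fin m × Fin m) ℂ) = Matrix.diagonal (fun p => d p.1)}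

/-- The left (row) torus. -/
def leftTorus (m : ℕ) : Subgroup (GL (Fin m × Fin m) ℂ) :=
  Subgroup.closure (leftTorusGen m)

/-- The top of the family: Grenet's bound assuming only LEFT-torus equivariance
(equivalently: Grenet's `2^m` nodes are optimal for unordered row-set-multilinear ABPs). -/
def LeftTorusBound : Prop :=
  EquivariantGrenetBound leftTorus

/-! ### The family is graded: more ties = smaller torus = stronger statement -/

theorem tiedTorusGen_anti {m k k' : ℕ} (h : k ≤ k') : tiedTorusGen m k' ⊆ tiedTorusGen m k := by
  rintro γ ⟨d, e, he, hγ⟩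
  exact ⟨d, e, fun j j' hj hj' => he j j' (hj.trans h) (hj'.trans h), hγ⟩

theorem tiedTorusBound_anti {k k' : ℕ} (h : k ≤ k') : TiedTorusBound k' → TiedTorusBound k :=
  fun H m hm n A hA => H m hm n A (hA.anti (Subgroup.closure_mono (tiedTorusGen_anti h)))

/-- With no tie (`k = 0`) the generating set is the floor's, literally. -/
theorem tiedTorusGen_zero (m : ℕ) :
    tiedTorusGen m 0 = {γ : GL (Fin m × Fin m) ℂ | ∃ d e : Fin m → ℂ,
      (γ : Matrix (Fin m × Fin m) (Fin m × Fin m) ℂ) = Matrix.diagonal (fun p => d p.1 * e p.2)} := by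
  ext γ
  constructor
  · rintro ⟨d, e, -, hγ⟩
    exact ⟨d, e, hγ⟩
  · rintro ⟨d, e, hγ⟩
    refine ⟨d, e, fun j j' hj hj' => ?_, hγ⟩
    have : j = j' := Fin.ext (by omega)
    rw [this]

/-- `TiedTorusBound 0` is the floor `TorusBound`. -/
theorem tiedTorusBound_zero_iff :
    TiedTorusBound 0 ↔ Summit.ValiantsHypothesis.ValiantsHypothesis.Theses.RigidityForcesSymmetry.TorusBound := by
  simp only [TiedTorusBound, EquivariantGrenetBound, tiedTorus, tiedTorusGen_zero,
    Summit.ValiantsHypothesis.ValiantsHypothesis.Theses.RigidityForcesSymmetry.TorusBound]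

/-- The rung implies the floor. -/
theorem torusBound_of_pairTied (h : PairTiedTorusBound) :
    Summit.ValiantsHypothesis.ValiantsHypothesis.Theses.RigidityForcesSymmetry.TorusBound :=
  tiedTorusBound_zero_iff.mp (tiedTorusBound_anti (Nat.zero_le 1) h)

/-- The left torus sits inside every tied torus (take `e ≡ 1`). -/
theorem leftTorusGen_subset_tiedTorusGen (m k : ℕ) : leftTorusGen m ⊆ tiedTorusGen m k := by
  rintro γ ⟨d, hγ⟩
  refine ⟨d, fun _ => 1, fun _ _ _ _ => rfl, ?_⟩
  simpa using hγ

/-- With all columns tied (`m ≤ k + 1`), the tied torus is generated inside the left torus. -/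
theorem tiedTorusGen_subset_leftTorusGen {m k : ℕ} (h : m ≤ k + 1) :
    tiedTorusGen m k ⊆ leftTorusGen m := by
  rintro γ ⟨d, e, he, hγ⟩
  by_cases hm : m = 0
  · subst hm
    refine ⟨d, ?_⟩
    rw [hγ]
    ext p
    exact Fin.elim0 p.1
  · have h0 : 0 < m := Nat.pos_of_ne_zero hm
    refine ⟨fun i => d i * e ⟨0, h0⟩, ?_⟩
    rw [hγ]
    congr 1
    funext p
    rw [he p.2 ⟨0, h0⟩ (by omega) (by simp)]

/-- The top of the family: `LeftTorusBound ↔ ∀ k, TiedTorusBound k`. -/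
theorem leftTorusBound_iff : LeftTorusBound ↔ ∀ k, TiedTorusBound k := by
  constructor
  · intro H k m hm n A hA
    exact H m hm n A (hA.anti (Subgroup.closure_mono (leftTorusGen_subset_tiedTorusGen m k)))
  · intro H m hm n A hA
    exact H m m hm n A
      (hA.anti (Subgroup.closure_mono (tiedTorusGen_subset_leftTorusGen (Nat.le_succ m))))


/-! ### Typed level decompositions of the permanent (the objects of the line) -/

/-- `P` is TYPED by the row set `I`, the untied column profile `c` and the tied total `ct` (tie on the
columns `j ≤ k`): every monomial of `P` has degree `1` in each row of `I` and `0` in the other rows,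
degree `c j` in each untied column `j` (`k < j`), and total degree `ct` in the tied columns.  (These
are exactly the weight spaces of a generic element of `tiedTorus m k` acting on polynomials.) -/
def IsTiedTyped (m k : ℕ) (I : Finset (Fin m)) (c : Fin m → ℕ) (ct : ℕ)
    (P : MvPolynomial (Fin m × Fin m) ℂ) : Prop :=
  ∀ d ∈ P.support,
    (∀ i : Fin m, (∑ j : Fin m, d (i, j)) = if i ∈ I then 1 else 0) ∧
    (∀ j : Fin m, k < j.val → (∑ i : Fin m, d (i, j)) = c j) ∧
    (∑ j ∈ Finset.univ.filter (fun j : Fin m => j.val ≤ k), ∑ i : Fin m, d (i, j)) = ct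

/-- `perm_m` has a LEVEL-`s` TYPED DECOMPOSITION WITH `w` PRODUCTS for the tie `k`:
`perm_m = Σ_{t < w} P_t · Q_t` with `P_t` typed by an `s`-set of rows `I_t` and `Q_t` typed by the
complementary rows and the complementary column profile.  (Cut of a `tiedTorus m k`-graded homogeneous
ABP at degree `s`; Grenet / Laplace along `s` rows give one with `w = C(m,s)`.) -/
def TiedLevelDecomposable (m k s w : ℕ) : Prop :=
  ∃ (I : Fin w → Finset (Fin m)) (c c' : Fin w → Fin m → ℕ) (ct ct' : Fin w → ℕ)
    (P Q : Fin w → MvPolynomial (Fin m × Fin m) ℂ),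
    (∀ t, (I t).card = s) ∧
    (∀ t, IsTiedTyped m k (I t) (c t) (ct t) (P t)) ∧
    (∀ t, IsTiedTyped m k (I t)ᶜ (c' t) (ct' t) (Q t)) ∧
    (∀ t, ∀ j : Fin m, k < j.val → c t j + c' t j = 1) ∧
    (∀ t, ct t + ct' t = (Finset.univ.filter (fun j : Fin m => j.val ≤ k)).card) ∧
    perPoly (Fin m) ℂ = ∑ t, P t * Q t

/-! ### The stubs -/

/-- **Extraction (dictionary; LR17 §3–§6 + von zur Gathen regularity, run for a tied torus).**  A
`tiedTorus m k`-equivariant (exact lifts) affine determinantal representation of `perm_m` (`m ≥ 3`) of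
size `n` yields, for every level `1 ≤ s ≤ m-1`, a level-`s` typed decomposition of `perm_m` with `w s`
products, where `1 + Σ_{s=1}^{m-1} w s ≤ n`.  (Regularity ⇒ constant part `0 ⊕ 1_{n-1}`; one generic
element of the tied torus — rows: distinct primes, untied columns: further distinct primes, tied columns:
one more prime — and its exact lift grade `ℂ^n`; variable weights are non-trivial so the linear part is
nilpotent in weight order and `det = perm_m` is the sum over source–sink paths of a homogeneous graded
ABP whose `n-1` internal nodes carry typed `(P_u, Q_u)`; cutting at degree `s` gives the level.)
[cite: LandsbergRessayre2017, §3, §6] [cite: Vonzurgathen1987, Thm. 3.1] -/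
theorem stub_levelDecomp :
    ∀ m k : ℕ, 3 ≤ m → ∀ (n : ℕ) (A : Matrix (Fin n) (Fin n) (MvPolynomial (Fin m × Fin m) ℂ)),
      IsEquivariantDetRepr (tiedTorus m k) (perPoly (Fin m) ℂ) A →
        ∃ w : ℕ → ℕ, (∑ s ∈ Finset.range (m - 1), w (s + 1)) + 1 ≤ n ∧
          ∀ s : ℕ, 1 ≤ s → s + 1 ≤ m → TiedLevelDecomposable m k s (w s) := by
  sorry

/-- **Sharp typed count with one tied pair (the new mathematics of the rung).**  For `m ≥ 3` and
`1 ≤ s ≤ m-1`, every level-`s` typed decomposition of `perm_m` for the tie `k = 1` uses at least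
`C(m,s)` products — exactly as many as without the tie, although a tied class `(I, J∪{0} ~ J∪{1})` may
now host products serving both completions.  (Why plausibly true: such a doubly-used product creates the
cross terms with column `0` twice / column `1` twice, absent from `perm_m`; cancelling them needs
further typed products at the same level — proved by hand at `m = 3`; the first open case is
`(m,s) = (4,2)`.  Why it might fail: a signed inclusion–exclusion over the tied pair could cancel the
cross terms across DIFFERENT row sets `I` at no cost.) [cite: LandsbergRessayre2017, §6]
[cite: Nisan1991] -/
theorem stub_levelBound :
    ∀ m : ℕ, 3 ≤ m → ∀ s w : ℕ, 1 ≤ s → s + 1 ≤ m →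
      TiedLevelDecomposable m 1 s w → m.choose s ≤ w := by
  sorry

/-! ### The composition (kernel-checked): the two stubs give the rung -/

/-- Arithmetic of the level count: `n ≥ 1 + Σ_{s=1}^{m-1} C(m,s) = 2^m - 1`. -/
theorem grenet_count_of_levels {m n : ℕ} (hm : 3 ≤ m) (w : ℕ → ℕ)
    (hsum : (∑ s ∈ Finset.range (m - 1), w (s + 1)) + 1 ≤ n)
    (hle : ∀ s : ℕ, 1 ≤ s → s + 1 ≤ m → m.choose s ≤ w s) : 2 ^ m - 1 ≤ n := by
  have hle' : ∀ s ∈ Finset.range (m - 1), m.choose (s + 1) ≤ w (s + 1) := fun s hs => by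
    rw [Finset.mem_range] at hs
    exact hle (s + 1) (Nat.succ_pos s) (by omega)
  have hchoose : (∑ s ∈ Finset.range (m - 1), m.choose (s + 1)) + 2 = 2 ^ m := by
    obtain ⟨m', rfl⟩ : ∃ m', m = m' + 1 := ⟨m - 1, by omega⟩
    have h := Nat.sum_range_choose (m' + 1)
    rw [Finset.sum_range_succ', Finset.sum_range_succ] at h
    simp only [Nat.choose_zero_right, Nat.choose_self, Nat.add_sub_cancel] at h ⊢
    omega
  have hsum' := Finset.sum_le_sum hle'
  calc 2 ^ m - 1 = (∑ s ∈ Finset.range (m - 1), m.choose (s + 1)) + 1 := by omega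
    _ ≤ (∑ s ∈ Finset.range (m - 1), w (s + 1)) + 1 := by omega
    _ ≤ n := hsum

/-- **The rung from the registered stubs, by name** (registrar shape `<Rung>_proof`; first theorem in
this file concluding `PairTiedTorusBound`). -/
theorem PairTiedTorusBound_proof : PairTiedTorusBound := by
  intro m hm n A hA
  obtain ⟨w, hsum, hdec⟩ := stub_levelDecomp m 1 hm n A hA
  exact grenet_count_of_levels hm w hsum
    (fun s hs hsm => stub_levelBound m hm s (w s) hs hsm (hdec s hs hsm))

/-- The same composition with the stub statements as hypotheses (BC3 shape `<Rung>_of`; it concludes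
`TiedTorusBound 1`, definitionally the rung, so that `PairTiedTorusBound_proof` stays the UNIQUE theorem of
this file concluding `PairTiedTorusBound` by name — the registrar takes the first such theorem). -/
theorem PairTiedTorusBound_of
    (h1 : ∀ m k : ℕ, 3 ≤ m → ∀ (n : ℕ) (A : Matrix (Fin n) (Fin n) (MvPolynomial (Fin m × Fin m) ℂ)),
      IsEquivariantDetRepr (tiedTorus m k) (perPoly (Fin m) ℂ) A →
        ∃ w : ℕ → ℕ, (∑ s ∈ Finset.range (m - 1), w (s + 1)) + 1 ≤ n ∧
          ∀ s : ℕ, 1 ≤ s → s + 1 ≤ m → TiedLevelDecomposable m k s (w s))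
    (h2 : ∀ m : ℕ, 3 ≤ m → ∀ s w : ℕ, 1 ≤ s → s + 1 ≤ m →
      TiedLevelDecomposable m 1 s w → m.choose s ≤ w) :
    TiedTorusBound 1 := by
  intro m hm n A hA
  obtain ⟨w, hsum, hdec⟩ := h1 m 1 hm n A hA
  exact grenet_count_of_levels hm w hsum (fun s hs hsm => h2 m hm s (w s) hs hsm (hdec s hs hsm))

example : (TiedTorusBound 1) = PairTiedTorusBound := rfl

/-! ### The compiled witness (F3 / BC5): the floor is the `k = 0` member of the family -/

/-- `TiedTorusBound 0` from the PROVED floor `stub_torusBound` (no sorry in its cone). -/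
theorem floor_rung : TiedTorusBound 0 := by
  simpa [TiedTorusBound, EquivariantGrenetBound, tiedTorus, tiedTorusGen_zero,
    Summit.ValiantsHypothesis.ValiantsHypothesis.Theses.RigidityForcesSymmetry.TorusBound] using
    Summit.ValiantsHypothesis.ValiantsHypothesis.Theorems.BorderApolarityToricWitnessObstructionQP.stub_torusBound

end Summit.ValiantsHypothesis.ValiantsHypothesis.Cruxes.RankRigidMinimalRepr.PairTiedTorusBound
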